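import Mathlib
import Summits.Ventures.PercRepro.TriangleCapStarFamilyGraph

/-!
# PercRepro — THE STAR FAMILY: THE OFF-DEGREES (p3, gen 56; part 317b)

The off-degrees of the graph `HSF` of part 317 at `w = 0` (`offDeg_HSF`): `offDeg HSF 0 v = offSF v` — every special
and regular column `D`, the centre `Rc + a`, the centre row `ℓ + 1 + ρ` `1 + kSF ρ` (the first one `D − short`), every
outer and extra row `D`, everything else `0`.  The inside edges add `a` at the centre and `1` at every special
(`card_SSF_filter`); the bipartite part contributes the classes of part 316 (`offDeg_H0SF_left`, `offDeg_H0SF_right`).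
Axioms: standard.
-/

namespace PercRepro

namespace TriangleCap

namespace C047

open Finset

/-- The number of inside edges at the vertex `v < n`: `a` at the centre, `1` at a special, `0` elsewhere. -/
theorem card_SSF_filter (s ℓ t a Q v : ℕ) (hℓ : a + Q + 1 ≤ ℓ) (hv : v < nSF s ℓ t) :
    ((SSF s ℓ t a Q).filter (fun e => fin' (nSF s ℓ t) (nSF_pos s ℓ t) v ∈ e)).card =
      if v = a + Q + 1 then a else if 1 ≤ v ∧ v ≤ a then 1 else 0 := by
  have hC : a + Q + 1 < nSF s ℓ t := by
    unfold nSF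
    omega
  unfold SSF
  rw [card_filter_image_of_injOn (fun c hc c' hc' h => by
    rw [mem_coe, mem_range] at hc hc'
    rw [Sym2.eq_iff] at h
    rcases h with ⟨-, h⟩ | ⟨h, -⟩
    · have := congrArg Fin.val h
      rw [fin'_val _ _ _ (by unfold nSF; omega), fin'_val _ _ _ (by unfold nSF; omega)] at this
      omega
    · have := congrArg Fin.val h
      rw [fin'_val _ _ _ hC, fin'_val _ _ _ (by unfold nSF; omega)] at this
      omega)]
  rw [filter_congr (q := fun c => v = a + Q + 1 ∨ v = 1 + c) (fun c hc =>
    mem_pair_iff' (nSF s ℓ t) (nSF_pos s ℓ t) v (a + Q + 1) (1 + c) hv hC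
      (by have := mem_range.mp hc; unfold nSF; omega))]
  split_ifs with h1 h2
  · rw [filter_true_of_mem (fun c _ => Or.inl h1), card_range]
  · rw [filter_congr (q := fun c => c = v - 1) (fun c hc => by
        have := mem_range.mp hc
        constructor
        · rintro (h | h)
          · omega
          · omega
        · intro h
          right
          omega),
      filter_eq' (range a) (v - 1), if_pos (mem_range.mpr (by omega)), card_singleton]
  · rw [card_eq_zero, filter_eq_empty_iff]
    intro c hc h
    have := mem_range.mp hc
    omega

/-- The off-degree of a left vertex in the bipartite part is its class. -/
theorem offDeg_H0SF_left (s ℓ t D a Rc short E Q : ℕ) (ha : 1 ≤ a) (hRc : 1 ≤ Rc) (hshort : short + 1 ≤ D)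
    (hQ : 1 ≤ Q) (hQ1 : D ≤ Q + 1) (hQE : 1 ≤ E → D ≤ Q)
    (hinc : Rc * (D - 1) + (D - 1) * (D - a) + E * D = Q * D + short) (hℓ : a + Q + 1 ≤ ℓ)
    (hN : Rc + (D - 1) + E ≤ s - t) (v : ℕ) (hv : v < ℓ + 1) :
    offDeg (H0SF s ℓ t D a Rc short E Q) (fin' (nSF s ℓ t) (nSF_pos s ℓ t) 0) (fin' (nSF s ℓ t) (nSF_pos s ℓ t) v) =
      cls (Rc + a * (D - 1) + Q * D) (lfSF D a Rc Q) v := by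
  have hg := goodEnds_SF (nSF s ℓ t) ℓ D a Rc short E Q ha hRc hshort hQ hQ1 hQE hinc hℓ (by unfold nSF; omega)
  rw [offDeg_genWitness_left (nSF s ℓ t) (ℓ + 1) (s - a) (Rc + a * (D - 1) + Q * D) (nSF_pos s ℓ t)
    (lfSF D a Rc Q) (rfSF ℓ D a Rc short E) hg (by unfold nSF; omega) v hv]
  rfl

/-- The off-degree of a right vertex in the bipartite part is its class. -/
theorem offDeg_H0SF_right (s ℓ t D a Rc short E Q : ℕ) (ha : 1 ≤ a) (hRc : 1 ≤ Rc) (hshort : short + 1 ≤ D)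
    (hQ : 1 ≤ Q) (hQ1 : D ≤ Q + 1) (hQE : 1 ≤ E → D ≤ Q)
    (hinc : Rc * (D - 1) + (D - 1) * (D - a) + E * D = Q * D + short) (hℓ : a + Q + 1 ≤ ℓ)
    (hN : Rc + (D - 1) + E ≤ s - t) (v : ℕ) (hv : ℓ + 1 ≤ v) (hvn : v < nSF s ℓ t) :
    offDeg (H0SF s ℓ t D a Rc short E Q) (fin' (nSF s ℓ t) (nSF_pos s ℓ t) 0) (fin' (nSF s ℓ t) (nSF_pos s ℓ t) v) =
      cls (Rc + a * (D - 1) + Q * D) (rfSF ℓ D a Rc short E) v := by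
  have hg := goodEnds_SF (nSF s ℓ t) ℓ D a Rc short E Q ha hRc hshort hQ hQ1 hQE hinc hℓ (by unfold nSF; omega)
  rw [offDeg_genWitness_right (nSF s ℓ t) (ℓ + 1) (s - a) (Rc + a * (D - 1) + Q * D) (nSF_pos s ℓ t)
    (lfSF D a Rc Q) (rfSF ℓ D a Rc short E) hg (by unfold nSF; omega) v hv hvn]
  rfl

/-- **THE OFF-DEGREES OF THE STAR FAMILY:** `offDeg HSF 0 v = offSF v` for `v < n`. -/
theorem offDeg_HSF (s ℓ t D a Rc short E Q : ℕ) (ha : 1 ≤ a) (hRc : 1 ≤ Rc) (hshort : short + 1 ≤ D)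
    (hQ : 1 ≤ Q) (hQ1 : D ≤ Q + 1) (hQE : 1 ≤ E → D ≤ Q)
    (hinc : Rc * (D - 1) + (D - 1) * (D - a) + E * D = Q * D + short) (hℓ : a + Q + 1 ≤ ℓ)
    (hN : Rc + (D - 1) + E ≤ s - t) (v : ℕ) (hv : v < nSF s ℓ t) :
    offDeg (HSF s ℓ t D a Rc short E Q) (fin' (nSF s ℓ t) (nSF_pos s ℓ t) 0) (fin' (nSF s ℓ t) (nSF_pos s ℓ t) v) =
      offSF ℓ D a Rc short E Q v := by
  rw [offDeg_addEdges _ _ (SSF_nondiag s ℓ t a Q hℓ) (SSF_new s ℓ t D a Rc short E Q hℓ) _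
    (SSF_zero s ℓ t a Q hℓ), card_SSF_filter s ℓ t a Q v hℓ hv]
  rcases Nat.eq_zero_or_pos v with rfl | hv1
  · rw [offDeg_self]
    unfold offSF
    rw [if_pos rfl, if_neg (show ¬ (0 = a + Q + 1) by omega), if_neg (show ¬ (1 ≤ 0 ∧ 0 ≤ a) by omega)]
  by_cases hva : v ≤ a
  · obtain ⟨c, rfl⟩ : ∃ c, v = 1 + c := ⟨v - 1, by omega⟩
    rw [offDeg_H0SF_left s ℓ t D a Rc short E Q ha hRc hshort hQ hQ1 hQE hinc hℓ hN (1 + c) (by omega),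
      cls_lfSF_special D a Rc Q c ha hQ (by omega)]
    unfold offSF
    split_ifs <;> omega
  by_cases hvq : v ≤ a + Q
  · obtain ⟨q, rfl⟩ : ∃ q, v = a + 1 + q := ⟨v - a - 1, by omega⟩
    rw [offDeg_H0SF_left s ℓ t D a Rc short E Q ha hRc hshort hQ hQ1 hQE hinc hℓ hN (a + 1 + q) (by omega),
      cls_lfSF_regular D a Rc Q q ha hQ (by omega)]
    unfold offSF
    split_ifs <;> omega
  by_cases hvc : v = a + Q + 1
  · subst hvc
    rw [offDeg_H0SF_left s ℓ t D a Rc short E Q ha hRc hshort hQ hQ1 hQE hinc hℓ hN (a + Q + 1) (by omega),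
      cls_lfSF_centre D a Rc Q ha hQ, if_pos rfl]
    unfold offSF
    rw [if_neg (show ¬ (a + Q + 1 = 0) by omega), if_neg (show ¬ (a + Q + 1 ≤ a) by omega),
      if_neg (show ¬ (a + Q + 1 ≤ a + Q) by omega), if_pos rfl]
  by_cases hvℓ : v ≤ ℓ
  · rw [offDeg_H0SF_left s ℓ t D a Rc short E Q ha hRc hshort hQ hQ1 hQE hinc hℓ hN v (by omega),
      cls_lfSF_zero D a Rc Q v ha hQ (Or.inr (by omega))]
    unfold offSF
    split_ifs <;> omega
  rw [offDeg_H0SF_right s ℓ t D a Rc short E Q ha hRc hshort hQ hQ1 hQE hinc hℓ hN v (by omega) hv]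
  by_cases hv2 : v < ℓ + 1 + Rc
  · obtain ⟨ρ, rfl⟩ : ∃ ρ, v = ℓ + 1 + ρ := ⟨v - (ℓ + 1), by omega⟩
    rw [cls_rfSF_centre_row ℓ D a Rc short E Q ρ hRc hshort hinc (by omega)]
    unfold offSF
    rw [Nat.add_sub_cancel_left]
    split_ifs <;> omega
  by_cases hv3 : v < ℓ + 1 + Rc + (D - 1)
  · obtain ⟨ρ', rfl⟩ : ∃ ρ', v = ℓ + 1 + Rc + ρ' := ⟨v - (ℓ + 1 + Rc), by omega⟩
    rw [cls_rfSF_outer_row ℓ D a Rc short E Q ρ' ha hRc hshort hinc (by omega)]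
    unfold offSF
    have e : ℓ + 1 + Rc + ρ' - (ℓ + 1) = Rc + ρ' := by omega
    rw [e]
    split_ifs <;> omega
  by_cases hv4 : v < ℓ + 1 + (Rc + (D - 1) + E)
  · obtain ⟨e, rfl⟩ : ∃ e, v = ℓ + 1 + (Rc + (D - 1) + e) := ⟨v - (ℓ + 1 + Rc + (D - 1)), by omega⟩
    rw [cls_rfSF_extra_row ℓ D a Rc short E Q e ha hRc hshort hinc (by omega)]
    unfold offSF
    split_ifs <;> omega
  rw [cls_rfSF_zero ℓ D a Rc short E Q v ha hRc hshort hinc (Or.inr (by omega))]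
  unfold offSF
  split_ifs <;> omega

end C047

end TriangleCap

end PercRepro
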